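import Summits.QuantumFields.QCD.Theorems.NestedDissectionSeaLightQuarkCompletionOfChiralCornerPinned
import Summits.QuantumFields.QCD.Theorems.NestedDissectionSeaLightQuarkCompletionBandPinsOfCorner

/-!
# Crux `LightQuarkCompletion` (stmt-QuantumFields-18066) — line `Sketch` rev 6, composition B in LOCATED form:
# the corner set of a regularisation and the helper `lightQuarkCompletion_of_chiralCornerPinnedExists`

Lead file (prover-line-stmt-QuantumFields-18066-c4-0, cycle 4, 2026-08-17) for the reshape of composition B of the line
`Sketch` (crux stmt-QuantumFields-18066 `Summit.QuantumFields.QCD.Theses.NestedDissectionSea.LightQuarkCompletion`).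

Rev 4/5 closed the crux from the frame (α) (`FrameAndSeparatorLawNegative.Frame`, item 17012), the text of the sibling item
`HeavyThresholdYMBridge.ChiralCompletion` (item 17661) and the ∀δ-form `ChiralCornerPinned`
(`∀ δ, (upShift reg δ).IsChiralAtZero → Body (upShift reg δ) 0 → PinPkg (upShift reg δ) 0`, landed composition
`lightQuarkCompletion_of_chiralCornerPinned`, p142691).  The composition only ever CONSUMES the pin at ONE corner — the `δ`
that item 17661 supplies — so the ∀δ-form also quantifies over corners that are formally possible but physically absent
(the CORNER SET `{δ | (upShift reg δ).IsChiralAtZero ∧ Body (upShift reg δ) 0}` is an order-connected subset of `ℝ`, §1,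
physically the single chiral offset; formally it may be a non-trivial interval, on which two-sided pins at two different
corners clash for compatible radii, Negative `PinClash`).  Rev 6 therefore registers the LOCATED (existential) form

  `ChiralCornerPinnedExists`: `HypAt Nf reg M₀ → (∃ δ, chiral ∧ body at the corner δ) → ∃ δ, chiral ∧ body ∧ PinPkg … 0`,

which is implied by the ∀δ-form (§2, one line) and still closes the crux with the same two items (§3): nothing landed is
lost (the rev-4/5 composition `lightQuarkCompletion_of_chiralCornerPinned`, p142691, is §3 after §2), and the one supplier-less
statement of composition B is now exactly what the composition uses.

Contents: §1 the corner set is order-connected (chirality at a corner descends to every lower offset; the body at a corner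
ascends to every higher offset; `Body (upShift reg δ) 0 ↔ Body reg δ`); §2 ∀δ-form ⇒ located form; §3 the composition
`Frame → (17661 text) → ChiralCornerPinnedExists → LightQuarkCompletion` (witness `upShift reg δ` at the pinned corner).
Pure logic over the landed Negative `Anatomy`; no definition is introduced; no Theses decl is asserted.
-/

noncomputable section

namespace Summit.QuantumFields.QCD.Theorems.LightQuarkJumpLine

open MeasureTheory Filter Topology Set
open Literature.MathematicalPhysics.QuantumFieldTheory Literature.MathematicalPhysics.QuantumLattice
  Literature.Probability.LatticeModels
open Summit.QuantumFields.QCD.Theorems.CoerciveSeaNegative (PinClause)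
open Summit.QuantumFields.QCD.Theorems.EarlyCrosserLawNegative (UpperPin)
open Summit.QuantumFields.QCD.Theorems.FrameAndSeparatorLawNegative (Frame)
open Summit.QuantumFields.QCD.Theorems.LightQuarkCompletion.Negative
  (PinPkg Body HypAt Concl upShift lightQuarkCompletion_iff upShift_scheme hasMassScaling_upShift
    hasAsymptoticScaling_upShift tendsto_mcrit_upShift body_upShift)

/-! ## §1 The corner set of a regularisation is order-connected -/

/-- Re-basing an up-shift: the scheme of `upShift reg δ'` at the tuple `m + (δ − δ')` is the scheme of `upShift reg δ` at `m`
(both are `reg.scheme (δ + m)`). [folklore] -/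
theorem upShift_scheme_rebase {Nf : ℕ} (reg : QCDRegularisation Nf) (δ δ' : ℝ) (m : Fin Nf → ℝ)
    (z shift : QCDField Nf → ℕ → ℝ) :
    (upShift reg δ').scheme (fun f => m f + (δ - δ')) z shift = (upShift reg δ).scheme m z shift := by
  rw [upShift_scheme, upShift_scheme]
  congr 1
  funext f
  ring

/-- **Chirality at a corner descends**: if `upShift reg δ` is chiral at zero then so is `upShift reg δ'` for every `δ' ≤ δ`
(a positive tuple without rate-`ε` gap above `δ` is, re-based, a positive tuple above `δ'`). [folklore] -/
theorem isChiralAtZero_upShift_anti {Nf : ℕ} (reg : QCDRegularisation Nf) {δ δ' : ℝ} (hle : δ' ≤ δ)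
    (h : (upShift reg δ).IsChiralAtZero) : (upShift reg δ').IsChiralAtZero := by
  intro ε hε
  obtain ⟨m, hm, hng⟩ := h ε hε
  refine ⟨fun f => m f + (δ - δ'), fun f => by linarith [hm f], ?_⟩
  rwa [upShift_scheme_rebase]

/-- **The body at the corner `δ` of the up-shift IS the body of `reg` above `δ`** (`(upShift reg δ).scheme m = reg.scheme (δ + m)`). [folklore] -/
theorem body_upShift_zero_iff {Nf : ℕ} (reg : QCDRegularisation Nf) (δ : ℝ) :
    Body Nf (upShift reg δ) 0 ↔ Body Nf reg δ := by
  constructor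
  · intro h m hm
    obtain ⟨z, shift, T, hQ, hN, hG, hP, Δ, hΔ, hT, hL⟩ := h (fun f => m f - δ) fun f => by linarith [hm f]
    have hs : (upShift reg δ).scheme (fun f => m f - δ) z shift = reg.scheme m z shift := by
      rw [upShift_scheme]
      congr 1
      funext f
      ring
    refine ⟨z, shift, T, ?_, hN, hG, hP, Δ, hΔ, hT, ?_⟩
    · rwa [← hs]
    · rwa [← hs]
  · intro h
    exact body_upShift (M₀ := δ) (M₁ := 0) (D := δ) (by linarith) h

/-- **The body at a corner ascends**: the body of `upShift reg δ` at zero threshold gives the body of `upShift reg δ'` at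
zero threshold for every `δ' ≥ δ`. [folklore] -/
theorem body_upShift_zero_mono {Nf : ℕ} (reg : QCDRegularisation Nf) {δ δ' : ℝ} (hle : δ ≤ δ')
    (h : Body Nf (upShift reg δ) 0) : Body Nf (upShift reg δ') 0 := by
  intro m hm
  obtain ⟨z, shift, T, hQ, hN, hG, hP, Δ, hΔ, hT, hL⟩ := h (fun f => m f + (δ' - δ)) fun f => by linarith [hm f]
  refine ⟨z, shift, T, ?_, hN, hG, hP, Δ, hΔ, hT, ?_⟩
  · rwa [← upShift_scheme_rebase reg δ' δ]
  · rwa [← upShift_scheme_rebase reg δ' δ]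

/-- **The corner set is order-connected.**  The set of RGI offsets `δ` at which the up-shift `upShift reg δ` is chiral at
zero AND carries the body at every positive tuple is an order-connected subset of `ℝ` (chirality descends, the body
ascends).  Physically it is the single chiral offset of `reg`; formally nothing in the typed clauses excludes a non-trivial
interval, which is why the line registers the located form of the corner pin (§2–§3). [folklore] -/
theorem ordConnected_cornerSet {Nf : ℕ} (reg : QCDRegularisation Nf) :
    OrdConnected {δ : ℝ | (upShift reg δ).IsChiralAtZero ∧ Body Nf (upShift reg δ) 0} := by
  refine ⟨fun δ₁ h₁ δ₂ h₂ δ hδ => ?_⟩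
  exact ⟨isChiralAtZero_upShift_anti reg hδ.2 h₂.1, body_upShift_zero_mono reg hδ.1 h₁.2⟩

/-! ## §2 The ∀δ-form of the corner pin implies the located form -/

/-- **`ChiralCornerPinned` (∀δ-form, rev 4/5 stub) implies `ChiralCornerPinnedExists` (located form, rev 6 stub)**: pin the
corner that is given. [folklore] -/
theorem chiralCornerPinnedExists_of_forall
    (h : ∀ Nf : ℕ, (Nf = 2 ∨ Nf = 3) → ∀ (reg : QCDRegularisation Nf) (M₀ : ℝ), HypAt Nf reg M₀ → ∀ δ : ℝ,
      (upShift reg δ).IsChiralAtZero → Body Nf (upShift reg δ) 0 → PinPkg Nf (upShift reg δ) 0) :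
    ∀ Nf : ℕ, (Nf = 2 ∨ Nf = 3) → ∀ (reg : QCDRegularisation Nf) (M₀ : ℝ), HypAt Nf reg M₀ →
      (∃ δ : ℝ, (upShift reg δ).IsChiralAtZero ∧ Body Nf (upShift reg δ) 0) →
      ∃ δ : ℝ, (upShift reg δ).IsChiralAtZero ∧ Body Nf (upShift reg δ) 0 ∧ PinPkg Nf (upShift reg δ) 0 := by
  rintro Nf hNf reg M₀ hH ⟨δ, hχ, hbody⟩
  exact ⟨δ, hχ, hbody, h Nf hNf reg M₀ hH δ hχ hbody⟩

/-! ## §3 Composition B in located form -/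

/-- **Item 17661's conclusion for `reg` inhabits the corner set**: the δ it supplies is a corner (chiral at zero, body at
every positive tuple) of the up-shift family of `reg`. [folklore] -/
theorem cornerSet_nonempty_of_chiralCompletionAt {Nf : ℕ} (reg : QCDRegularisation Nf)
    (h : ∃ δ : ℝ, (∀ ε > (0 : ℝ), ∃ m : Fin Nf → ℝ, (∀ f, 0 < m f) ∧
        ¬ (reg.scheme (fun f => m f + δ) 0 0).HasLatticeMassGap ε) ∧
      ∀ m : Fin Nf → ℝ, (∀ f, 0 < m f) → ∃ (z shift : QCDField Nf → ℕ → ℝ) (T : OSData (QCDField Nf) 4),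
        IsQCDAlong (reg.scheme (fun f => m f + δ) z shift) T ∧ T.IsNontrivial QCDField.glue ∧
          T.IsNonGaussian QCDField.glue ∧ (∀ f g : Fin Nf, f ≠ g → T.IsNontrivial (QCDField.pseudoRe f g)) ∧
            ∃ Δ > 0, T.HasMassGap Δ ∧ (reg.scheme (fun f => m f + δ) z shift).HasLatticeMassGap Δ) :
    ∃ δ : ℝ, (upShift reg δ).IsChiralAtZero ∧ Body Nf (upShift reg δ) 0 := by
  obtain ⟨δ, hχ, hbodyδ⟩ := h
  exact ⟨δ, isChiralAtZero_upShift_of_addConst reg δ hχ, body_upShift_zero_of_addConst reg δ hbodyδ⟩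

/-- **The crux along line `Sketch`, composition B in located form** (registered helper; pure bookkeeping, conclusion = the
route decl BY NAME, no subsequence).  From the frame (α) (`Frame`, item 17012), the verbatim text of
`HeavyThresholdYMBridge.ChiralCompletion` (item 17661) and `ChiralCornerPinnedExists` (a threshold-pinned regularisation whose
up-shift family has a corner — an offset chiral at zero carrying the body at every positive tuple — has a corner carrying the
two-sided parity pin at ZERO threshold as well), the crux `LightQuarkCompletion` follows: item 17661 inhabits the corner set
(`cornerSet_nonempty_of_chiralCompletionAt`, through the landed `isChiralAtZero_upShift_of_addConst` /
`body_upShift_zero_of_addConst`), the stub pins a corner `δ`, both scalings survive the up-shift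
(`hasMassScaling_upShift`, `hasAsymptoticScaling_upShift`), and (α) through `physicalBranch_of_frame` gives `m_crit → 0` for
`reg`, hence for `upShift reg δ` (`tendsto_mcrit_upShift`, `N_f ≤ 16`).  Witness: `reg' := upShift reg δ`. [folklore] -/
theorem lightQuarkCompletion_of_chiralCornerPinnedExists :
    Frame → (∀ Nf : ℕ, Nf = 2 ∨ Nf = 3 → ∀ (reg : QCDRegularisation Nf) (M₀ : ℝ), reg.HasMassScaling → (∀ m : Fin Nf →
    ℝ, (∀ f, M₀ < m f) → ∃ (z shift : QCDField Nf → ℕ → ℝ) (T : OSData (QCDField Nf) 4), IsQCDAlong (reg.scheme m z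
    shift) T ∧ T.IsNontrivial QCDField.glue ∧ T.IsNonGaussian QCDField.glue ∧ (∀ f g : Fin Nf, f ≠ g → T.IsNontrivial
    (QCDField.pseudoRe f g)) ∧ ∃ Δ > 0, T.HasMassGap Δ ∧ (reg.scheme m z shift).HasLatticeMassGap Δ) → ∃ δ : ℝ, (∀ ε >
    (0 : ℝ), ∃ m : Fin Nf → ℝ, (∀ f, 0 < m f) ∧ ¬ (reg.scheme (fun f => m f + δ) 0 0).HasLatticeMassGap ε) ∧ ∀ m : Fin
    Nf → ℝ, (∀ f, 0 < m f) → ∃ (z shift : QCDField Nf → ℕ → ℝ) (T : OSData (QCDField Nf) 4), IsQCDAlong (reg.scheme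
    (fun f => m f + δ) z shift) T ∧ T.IsNontrivial QCDField.glue ∧ T.IsNonGaussian QCDField.glue ∧ (∀ f g : Fin Nf, f
    ≠ g → T.IsNontrivial (QCDField.pseudoRe f g)) ∧ ∃ Δ > 0, T.HasMassGap Δ ∧ (reg.scheme (fun f => m f + δ) z
    shift).HasLatticeMassGap Δ) → (∀ Nf : ℕ, (Nf = 2 ∨ Nf = 3) → ∀ (reg : QCDRegularisation Nf) (M₀ : ℝ), HypAt Nf reg
    M₀ → (∃ δ : ℝ, (upShift reg δ).IsChiralAtZero ∧ Body Nf (upShift reg δ) 0) → ∃ δ : ℝ, (upShift reg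
    δ).IsChiralAtZero ∧ Body Nf (upShift reg δ) 0 ∧ PinPkg Nf (upShift reg δ) 0) →
    Summit.QuantumFields.QCD.Theses.NestedDissectionSea.LightQuarkCompletion := by
  intro hF hCC hCP
  rw [lightQuarkCompletion_iff]
  intro Nf hNf reg M₀ hH
  obtain ⟨hMS, hAS, hbr, hM₀, hpin, hbody⟩ := hH
  have hNf16 : Nf ≤ 16 := by rcases hNf with rfl | rfl <;> norm_num
  -- item 17661 inhabits the corner set of `reg`
  have hcorner : ∃ δ : ℝ, (upShift reg δ).IsChiralAtZero ∧ Body Nf (upShift reg δ) 0 :=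
    cornerSet_nonempty_of_chiralCompletionAt reg (hCC Nf hNf reg M₀ hMS hbody)
  -- the stub pins ONE corner
  obtain ⟨δ, hχ', hbody', hpin'⟩ := hCP Nf hNf reg M₀ ⟨hMS, hAS, hbr, hM₀, hpin, hbody⟩ hcorner
  -- the physical branch from the frame (α), transported through the up-shift
  have hlim : Tendsto reg.mcrit atTop (𝓝 0) := physicalBranch_of_frame hF Nf hNf reg hMS hAS M₀ hM₀ hpin
  exact ⟨upShift reg δ, (hasMassScaling_upShift reg δ).2 hMS, (hasAsymptoticScaling_upShift reg δ).2 hAS,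
    tendsto_mcrit_upShift reg δ hNf16 hMS hlim, hpin', hχ', hbody'⟩

end Summit.QuantumFields.QCD.Theorems.LightQuarkJumpLine

end
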